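import Mathlib
import Summits.CriticalPhenomena.CardyFormulaZ2.Theorems.CardyMagicRigidityNestingRigidityCloudAdmissibility
import Literature.Analysis.Complex.PolydiscWeightedMeanValue
import HarnessLib

/-!
# Shell formula for the planar logarithmic potential (line `ring-cloud-tomography`, stub S1b)

Crux `Summit.CriticalPhenomena.CardyFormulaZ2.Theses.CardyMagicRigidity.NestingRigidity`
(stmt-CriticalPhenomena-4835), line `ring-cloud-tomography`, stub `stub_cloudEnergy : CloudEnergy`.
This file is the potential-theoretic engine of that stub (part (A) of its proof): polar coordinates
with Fubini on `ℂ` (integrability transfer through Mathlib's change of variables), local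
integrability of `log ‖·‖` in the plane, the circle integral
`∫_{-π}^{π} log ‖q - s e^{iθ}‖ dθ = 2π log (max s ‖q‖)` (Mathlib's
`circleAverage_log_norm_sub_const_eq_log_radius_add_posLog`), and the SHELL FORMULA
`∫_{L ≤ ‖z - c‖ < M} log ‖p - z‖ dz = 2π ∫_L^M s log (max s ‖p - c‖) ds` together with its radial
companion `∫_{L ≤ ‖z - c‖ < M} φ ‖z - c‖ dz = 2π ∫_L^M s φ s ds` and the elementary integrals
`∫ s log s`, `∫ s log (max s t)`.  Measurability and area of the annulus are those of the sibling
stub file `CardyMagicRigidityNestingRigidityCloudAdmissibility` (S1a);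
`polarCoord.symm = circleMap 0` is `Literature.Analysis.Complex.polarCoord_symm_eq_circleMap`.
-/

noncomputable section

open MeasureTheory Set Filter Metric Real
open scoped Real Topology BigOperators

namespace Summit.CriticalPhenomena.CardyFormulaZ2.Cruxes.NestingRigidity.RingCloudTomography

/-! ## §1 Polar coordinates on `ℂ`: integrability transfer and Fubini -/

/-- Integrability transfer for polar coordinates on `ℂ`: `f` is integrable on the plane iff
`(s, θ) ↦ s • f (s e^{iθ})` is integrable on `(0, ∞) × (-π, π)`. -/
theorem integrableOn_polarCoord_iff {E : Type*} [NormedAddCommGroup E] [NormedSpace ℝ E]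
    (f : ℂ → E) :
    IntegrableOn (fun p : ℝ × ℝ ↦ p.1 • f (Complex.polarCoord.symm p)) polarCoord.target ↔
      Integrable f := by
  set g : ℝ × ℝ → E := f ∘ Complex.measurableEquivRealProd.symm with hg
  have h1 : Integrable f ↔ Integrable g :=
    ((Complex.volume_preserving_equiv_real_prod.symm _).integrable_comp_emb
      Complex.measurableEquivRealProd.symm.measurableEmbedding).symm
  have h2 : Integrable g ↔ IntegrableOn g (polarCoord.symm '' polarCoord.target) := by
    rw [polarCoord.symm_image_target_eq_source, ← integrableOn_univ]
    exact integrableOn_congr_set_ae polarCoord_source_ae_eq_univ.symm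
  rw [h1, h2, integrableOn_image_iff_integrableOn_abs_det_fderiv_smul volume
    polarCoord.open_target.measurableSet
    (fun p _ ↦ (hasFDerivAt_polarCoord_symm p).hasFDerivWithinAt) polarCoord.symm.injOn]
  refine integrableOn_congr_fun (fun p hp ↦ ?_) polarCoord.open_target.measurableSet
  have hp1 : 0 < p.1 := hp.1
  simp only [det_fderivPolarCoordSymm, hg, Function.comp_apply,
    Complex.measurableEquivRealProd_symm_polarCoord_symm_apply, abs_of_pos hp1]

/-- Polar coordinates with Fubini: for an integrable `f : ℂ → ℝ`,
`∫ f = ∫_{s > 0} ∫_{θ ∈ (-π, π)} s f(s e^{iθ}) dθ ds`. -/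
theorem integral_eq_integral_polar {f : ℂ → ℝ} (hf : Integrable f) :
    ∫ z, f z = ∫ s in Ioi (0 : ℝ), ∫ θ in Ioo (-π) π, s * f (circleMap 0 s θ) := by
  have hint := (integrableOn_polarCoord_iff f).2 hf
  rw [polarCoord_target] at hint
  rw [← Complex.integral_comp_polarCoord_symm, polarCoord_target, Measure.volume_eq_prod,
    setIntegral_prod _ hint]
  simp only [smul_eq_mul, Literature.Analysis.Complex.polarCoord_symm_eq_circleMap]

/-! ## §2 Local integrability of the logarithm in the plane -/

/-- `z ↦ log ‖z‖` is integrable on every disc `B(0, R)` of the plane (in polar coordinates the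
integrand is `s log s` on `(0, R) × (-π, π)`, a continuous function on a compact rectangle). -/
theorem integrableOn_log_norm_ball (R : ℝ) :
    IntegrableOn (fun z : ℂ ↦ Real.log ‖z‖) (ball 0 R) := by
  rw [← integrable_indicator_iff measurableSet_ball, ← integrableOn_polarCoord_iff]
  have hk : IntegrableOn (fun p : ℝ × ℝ ↦ p.1 * Real.log p.1) (Ioo 0 R ×ˢ Ioo (-π) π) :=
    (((continuous_mul_log.comp continuous_fst).continuousOn.integrableOn_compact
      (isCompact_Icc.prod isCompact_Icc)).mono_set
      (prod_mono Ioo_subset_Icc_self Ioo_subset_Icc_self))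
  have hk' : IntegrableOn ((Iio R ×ˢ univ).indicator fun p : ℝ × ℝ ↦ p.1 * Real.log p.1)
      polarCoord.target := by
    rw [integrableOn_indicator_iff (measurableSet_Iio.prod MeasurableSet.univ), polarCoord_target,
      prod_inter_prod, univ_inter, Iio_inter_Ioi]
    exact hk
  refine hk'.congr_fun (fun p hp ↦ ?_) polarCoord.open_target.measurableSet
  have hp1 : 0 < p.1 := hp.1
  have hnorm : ‖circleMap 0 p.1 p.2‖ = p.1 := by rw [norm_circleMap_zero, abs_of_pos hp1]
  rw [Literature.Analysis.Complex.polarCoord_symm_eq_circleMap]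
  by_cases hR : p.1 < R
  · have hmem : circleMap 0 p.1 p.2 ∈ ball (0 : ℂ) R := by rwa [mem_ball_zero_iff, hnorm]
    have hmem' : p ∈ Iio R ×ˢ (univ : Set ℝ) := ⟨hR, mem_univ _⟩
    simp only [indicator_of_mem hmem, indicator_of_mem hmem', hnorm, smul_eq_mul]
  · have hmem : circleMap 0 p.1 p.2 ∉ ball (0 : ℂ) R := by rwa [mem_ball_zero_iff, hnorm]
    have hmem' : p ∉ Iio R ×ˢ (univ : Set ℝ) := fun h ↦ hR h.1
    simp only [indicator_of_notMem hmem, indicator_of_notMem hmem', smul_zero]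

/-- `z ↦ log ‖p - z‖` is integrable on every disc `B(p, R)` about the singularity. -/
theorem integrableOn_log_norm_sub_ball (p : ℂ) (R : ℝ) :
    IntegrableOn (fun z : ℂ ↦ Real.log ‖p - z‖) (ball p R) := by
  have hmp : MeasurePreserving (fun z : ℂ ↦ p - z) volume volume :=
    Measure.measurePreserving_sub_left volume p
  have hme : MeasurableEmbedding (fun z : ℂ ↦ p - z) :=
    (MeasurableEquiv.subLeft p).measurableEmbedding
  have hpre : (fun z : ℂ ↦ p - z) ⁻¹' (ball 0 R) = ball p R := by
    ext z
    simp [mem_ball, dist_eq_norm, norm_sub_rev]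
  have h := (hmp.integrableOn_comp_preimage hme (f := fun z : ℂ ↦ Real.log ‖z‖) (s := ball 0 R)).2
    (integrableOn_log_norm_ball R)
  rwa [hpre] at h

/-- `z ↦ log ‖p - z‖` is integrable on the annulus `L ≤ ‖z - c‖ < M` (indeed on any bounded set). -/
theorem integrableOn_log_norm_sub_annulus (p c : ℂ) (L M : ℝ) :
    IntegrableOn (fun z : ℂ ↦ Real.log ‖p - z‖) {z : ℂ | L ≤ ‖z - c‖ ∧ ‖z - c‖ < M} := by
  refine (integrableOn_log_norm_sub_ball p (M + ‖c - p‖)).mono_set fun z hz ↦ ?_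
  rw [mem_ball, dist_eq_norm]
  calc ‖z - p‖ = ‖(z - c) + (c - p)‖ := by rw [sub_add_sub_cancel]
    _ ≤ ‖z - c‖ + ‖c - p‖ := norm_add_le _ _
    _ < M + ‖c - p‖ := by linarith [hz.2]

/-! ## §3 Integration over an annulus in polar coordinates -/

/-- For `0 ≤ L ≤ M`, the radial set `(0, ∞) ∩ [L, M)` is a.e. the interval `(L, M]`. -/
theorem Ioi_inter_Ico_ae_eq_Ioc {L M : ℝ} (hL : 0 ≤ L) :
    (Ioi (0 : ℝ) ∩ Ico L M : Set ℝ) =ᵐ[volume] Ioc L M := by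
  refine ae_eq_set.2 ⟨measure_mono_null (fun s hs ↦ ?_) (volume_singleton (a := L)),
    measure_mono_null (fun s hs ↦ ?_) (volume_singleton (a := M))⟩
  · simp only [Set.mem_sdiff, mem_inter_iff, mem_Ioi, mem_Ico, mem_Ioc, not_and, not_le] at hs
    rw [mem_singleton_iff]
    by_contra h
    exact (lt_irrefl _) ((hs.2 (lt_of_le_of_ne hs.1.2.1 (Ne.symm h))).trans hs.1.2.2)
  · simp only [Set.mem_sdiff, mem_inter_iff, mem_Ioi, mem_Ico, mem_Ioc, not_and, not_lt] at hs
    rw [mem_singleton_iff]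
    exact le_antisymm hs.1.2 (hs.2 (hL.trans_lt hs.1.1) hs.1.1.le)

/-- A radial set integral over `(0, ∞) ∩ [L, M)` is the interval integral over `[L, M]`. -/
theorem setIntegral_Ioi_inter_Ico {φ : ℝ → ℝ} {L M : ℝ} (hL : 0 ≤ L) (hLM : L ≤ M) :
    ∫ s in Ioi (0 : ℝ) ∩ Ico L M, φ s = ∫ s in L..M, φ s := by
  rw [intervalIntegral.integral_of_le hLM]
  exact setIntegral_congr_set (Ioi_inter_Ico_ae_eq_Ioc (M := M) hL)

/-- **Annulus integrals in polar coordinates.** For `h` integrable on the annulus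
`A = {L ≤ ‖z - c‖ < M}` (`0 ≤ L`),
`∫_A h = ∫_{s ∈ (0,∞) ∩ [L,M)} s ∫_{-π}^{π} h(c + s e^{iθ}) dθ ds`. -/
theorem setIntegral_annulus_eq_polar {h : ℂ → ℝ} {c : ℂ} {L M : ℝ}
    (hint : IntegrableOn h {z : ℂ | L ≤ ‖z - c‖ ∧ ‖z - c‖ < M}) :
    ∫ z in {z : ℂ | L ≤ ‖z - c‖ ∧ ‖z - c‖ < M}, h z =
      ∫ s in Ioi (0 : ℝ) ∩ Ico L M, s * ∫ θ in Ioo (-π) π, h (c + circleMap 0 s θ) := by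
  set A : Set ℂ := {z : ℂ | L ≤ ‖z - c‖ ∧ ‖z - c‖ < M} with hA
  set A₀ : Set ℂ := {z : ℂ | L ≤ ‖z‖ ∧ ‖z‖ < M} with hA₀
  have hAm : MeasurableSet A := CloudAdmissibility.measurableSet_annulus c L M
  have hA₀m : MeasurableSet A₀ := by
    simpa [hA₀] using CloudAdmissibility.measurableSet_annulus 0 L M
  -- Step 1: translate the centre to the origin
  have hshift : ∀ z : ℂ, A.indicator h (c + z) = A₀.indicator (fun w ↦ h (c + w)) z := fun z ↦ by
    simp only [hA, hA₀, indicator_apply, mem_setOf_eq, add_sub_cancel_left]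
  have h1 : ∫ z in A, h z = ∫ z, A₀.indicator (fun w ↦ h (c + w)) z := by
    rw [← integral_indicator hAm, ← integral_add_left_eq_self (A.indicator h) c]
    exact integral_congr_ae (Eventually.of_forall hshift)
  have hint₀ : Integrable (A₀.indicator fun w ↦ h (c + w)) := by
    have hi : Integrable (A.indicator h) := hint.integrable_indicator hAm
    have := hi.comp_add_left c
    exact this.congr (Eventually.of_forall hshift)
  -- Step 2: polar coordinates and Fubini
  rw [h1, integral_eq_integral_polar hint₀, ← setIntegral_indicator measurableSet_Ico]
  refine setIntegral_congr_fun measurableSet_Ioi fun s hs ↦ ?_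
  have hs0 : 0 < s := hs
  have hmemA₀ : ∀ θ, circleMap 0 s θ ∈ A₀ ↔ s ∈ Ico L M := fun θ ↦ by
    simp [hA₀, norm_circleMap_zero, abs_of_pos hs0]
  by_cases hsI : s ∈ Ico L M
  · rw [indicator_of_mem hsI, ← integral_const_mul]
    refine integral_congr_ae (Eventually.of_forall fun θ ↦ ?_)
    simp only [indicator_of_mem ((hmemA₀ θ).2 hsI)]
  · rw [indicator_of_notMem hsI]
    have h0 : ∀ θ, A₀.indicator (fun w ↦ h (c + w)) (circleMap 0 s θ) = 0 := fun θ ↦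
      indicator_of_notMem (fun hm ↦ hsI ((hmemA₀ θ).1 hm)) _
    simp [h0]

/-! ## §4 The circle integral of `log ‖q - ·‖` -/

/-- `log s + log⁺ (t / s) = log (max s t)` for `s > 0`, `t ≥ 0`. -/
theorem log_add_posLog_inv_mul {s t : ℝ} (hs : 0 < s) (ht : 0 ≤ t) :
    Real.log s + log⁺ (s⁻¹ * t) = Real.log (max s t) := by
  rcases le_or_gt t s with hts | hst
  · rw [max_eq_left hts, (posLog_eq_zero_iff _).2 _, add_zero]
    rw [abs_of_nonneg (by positivity)]
    exact inv_mul_le_one_of_le₀ hts hs.le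
  · have ht0 : 0 < t := hs.trans hst
    rw [max_eq_right hst.le, posLog_eq_log, Real.log_mul (inv_ne_zero hs.ne') ht0.ne',
      Real.log_inv]
    · ring
    · rw [abs_of_nonneg (by positivity), le_inv_mul_iff₀ hs, mul_one]
      exact hst.le

/-- **The circle integral of the logarithm**: for `s > 0` and any `q : ℂ`,
`∫_{-π}^{π} log ‖q - s e^{iθ}‖ dθ = 2π log (max s ‖q‖)` (mean-value property of `log ‖q - ·‖`;
Mathlib's `circleAverage_log_norm_sub_const_eq_log_radius_add_posLog`). -/
theorem setIntegral_log_norm_sub_circleMap (q : ℂ) {s : ℝ} (hs : 0 < s) :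
    ∫ θ in Ioo (-π) π, Real.log ‖q - circleMap 0 s θ‖ = 2 * π * Real.log (max s ‖q‖) := by
  have hper : Function.Periodic (fun θ ↦ Real.log ‖q - circleMap 0 s θ‖) (2 * π) := fun θ ↦ by
    simp only [periodic_circleMap 0 s θ]
  have h := hper.intervalIntegral_add_eq (-π) 0
  rw [zero_add, show -π + 2 * π = π by ring] at h
  rw [← integral_Ioc_eq_integral_Ioo, ← intervalIntegral.integral_of_le (by linarith [pi_pos]), h]
  have h2 : ∫ θ in (0 : ℝ)..2 * π, Real.log ‖q - circleMap 0 s θ‖ =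
      2 * π * circleAverage (fun z ↦ Real.log ‖z - q‖) 0 s := by
    rw [circleAverage_def, smul_eq_mul, ← mul_assoc, mul_inv_cancel₀ (by positivity), one_mul]
    exact intervalIntegral.integral_congr fun θ _ ↦ by simp [norm_sub_rev]
  rw [h2, circleAverage_log_norm_sub_const_eq_log_radius_add_posLog hs.ne', zero_sub, norm_neg,
    log_add_posLog_inv_mul hs (norm_nonneg q)]

/-! ## §5 The shell formula -/

/-- **Shell formula.** For `c p : ℂ` and `0 ≤ L ≤ M`:
`∫_{L ≤ ‖z - c‖ < M} log ‖p - z‖ dz = 2π ∫_L^M s log (max s ‖p - c‖) ds`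
(translate, polar coordinates, Fubini, and the circle integral of the logarithm shell by shell). -/
theorem setIntegral_annulus_log_norm_sub (c p : ℂ) {L M : ℝ} (hL : 0 ≤ L) (hLM : L ≤ M) :
    ∫ z in {z : ℂ | L ≤ ‖z - c‖ ∧ ‖z - c‖ < M}, Real.log ‖p - z‖ =
      2 * π * ∫ s in L..M, s * Real.log (max s ‖p - c‖) := by
  rw [setIntegral_annulus_eq_polar (integrableOn_log_norm_sub_annulus p c L M),
    ← setIntegral_Ioi_inter_Ico hL hLM, ← integral_const_mul]
  refine setIntegral_congr_fun (measurableSet_Ioi.inter measurableSet_Ico) fun s hs ↦ ?_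
  have hs0 : 0 < s := hs.1
  have hsub : ∀ θ, p - (c + circleMap 0 s θ) = (p - c) - circleMap 0 s θ := fun θ ↦ by ring
  simp only [hsub, setIntegral_log_norm_sub_circleMap (p - c) hs0]
  ring

/-- **Shell formula** (registered sub-goal form of `setIntegral_annulus_log_norm_sub`):
`∫_{L ≤ ‖z - c‖ < M} log ‖p - z‖ dz = 2π ∫_L^M s log (max s ‖p - c‖) ds` for `0 ≤ L ≤ M`. -/
theorem shellFormula : ∀ (c p : ℂ) (L M : ℝ), 0 ≤ L → L ≤ M →
    ∫ z in {z : ℂ | L ≤ ‖z - c‖ ∧ ‖z - c‖ < M}, Real.log ‖p - z‖ =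
      2 * π * ∫ s in L..M, s * Real.log (max s ‖p - c‖) :=
  fun c p _ _ hL hLM ↦ setIntegral_annulus_log_norm_sub c p hL hLM

/-! ## §6 Radial integrands -/

/-- The closed annulus `L ≤ ‖z - c‖ ≤ M` is compact. -/
theorem isCompact_closedAnnulus (c : ℂ) (L M : ℝ) :
    IsCompact {z : ℂ | L ≤ ‖z - c‖ ∧ ‖z - c‖ ≤ M} := by
  have : {z : ℂ | L ≤ ‖z - c‖ ∧ ‖z - c‖ ≤ M} = (fun z : ℂ ↦ ‖z - c‖) ⁻¹' Icc L M := rfl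
  rw [this]
  refine Metric.isCompact_of_isClosed_isBounded (isClosed_Icc.preimage (by fun_prop)) ?_
  refine (isBounded_closedBall (x := c) (r := M)).subset fun z hz ↦ ?_
  rw [mem_closedBall, dist_eq_norm]
  exact hz.2

/-- A function continuous on the closed annulus is integrable on the annulus `L ≤ ‖z - c‖ < M`. -/
theorem integrableOn_annulus_of_continuousOn {g : ℂ → ℝ} {c : ℂ} {L M : ℝ}
    (hg : ContinuousOn g {z : ℂ | L ≤ ‖z - c‖ ∧ ‖z - c‖ ≤ M}) :
    IntegrableOn g {z : ℂ | L ≤ ‖z - c‖ ∧ ‖z - c‖ < M} :=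
  (hg.integrableOn_compact (isCompact_closedAnnulus c L M)).mono_set fun _ hz ↦ ⟨hz.1, hz.2.le⟩

/-- **Radial integration over an annulus.** For `φ` continuous on `[L, M]` (`0 ≤ L ≤ M`):
`∫_{L ≤ ‖z - c‖ < M} φ ‖z - c‖ dz = 2π ∫_L^M s φ s ds`. -/
theorem setIntegral_annulus_radial (c : ℂ) {L M : ℝ} (hL : 0 ≤ L) (hLM : L ≤ M) {φ : ℝ → ℝ}
    (hφ : ContinuousOn φ (Icc L M)) :
    ∫ z in {z : ℂ | L ≤ ‖z - c‖ ∧ ‖z - c‖ < M}, φ ‖z - c‖ = 2 * π * ∫ s in L..M, s * φ s := by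
  have hint : IntegrableOn (fun z : ℂ ↦ φ ‖z - c‖) {z : ℂ | L ≤ ‖z - c‖ ∧ ‖z - c‖ < M} :=
    integrableOn_annulus_of_continuousOn (hφ.comp (by fun_prop) fun z hz ↦ hz)
  rw [setIntegral_annulus_eq_polar hint, ← setIntegral_Ioi_inter_Ico hL hLM, ← integral_const_mul]
  refine setIntegral_congr_fun (measurableSet_Ioi.inter measurableSet_Ico) fun s hs ↦ ?_
  have hs0 : 0 < s := hs.1
  have hn : ∀ θ, ‖c + circleMap 0 s θ - c‖ = s := fun θ ↦ by
    rw [add_sub_cancel_left, norm_circleMap_zero, abs_of_pos hs0]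
  simp only [hn, setIntegral_const, Measure.real, Real.volume_Ioo, smul_eq_mul,
    ENNReal.toReal_ofReal (by linarith [pi_pos] : (0 : ℝ) ≤ π - -π)]
  ring

/-- The second radial moment of the annulus: `∫_{L ≤ ‖z - c‖ < M} ‖z - c‖² = π (M⁴ - L⁴) / 2`. -/
theorem setIntegral_annulus_norm_sq (c : ℂ) {L M : ℝ} (hL : 0 ≤ L) (hLM : L ≤ M) :
    ∫ z in {z : ℂ | L ≤ ‖z - c‖ ∧ ‖z - c‖ < M}, ‖z - c‖ ^ 2 = π * (M ^ 4 - L ^ 4) / 2 := by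
  have h := setIntegral_annulus_radial c hL hLM (φ := fun s ↦ s ^ 2) (continuousOn_pow 2)
  rw [h]
  have : ∫ s in L..M, s * s ^ 2 = (M ^ 4 - L ^ 4) / 4 := by
    rw [show (fun s : ℝ ↦ s * s ^ 2) = fun s ↦ s ^ 3 by funext s; ring, integral_pow]
    norm_num
  rw [this]
  ring

/-! ## §7 The elementary radial integrals -/

/-- `∫_L^M s log s ds = (M²/2 log M - M²/4) - (L²/2 log L - L²/4)` for `0 ≤ L ≤ M`
(with Lean's `log 0 = 0` the primitive `s²/2 log s - s²/4` is continuous on `[0, ∞)`). -/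
theorem integral_mul_log {L M : ℝ} (hL : 0 ≤ L) (hLM : L ≤ M) :
    ∫ s in L..M, s * Real.log s =
      (M ^ 2 / 2 * Real.log M - M ^ 2 / 4) - (L ^ 2 / 2 * Real.log L - L ^ 2 / 4) := by
  have hF : (fun s : ℝ ↦ s ^ 2 / 2 * Real.log s - s ^ 2 / 4) =
      fun s ↦ s / 2 * (s * Real.log s) - s ^ 2 / 4 := by
    funext s; ring
  refine intervalIntegral.integral_eq_sub_of_hasDerivAt_of_le hLM
    (f := fun s : ℝ ↦ s ^ 2 / 2 * Real.log s - s ^ 2 / 4) ?_ (fun s hs ↦ ?_)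
    (continuous_mul_log.intervalIntegrable _ _)
  · rw [hF]
    exact (((continuous_id.div_const 2).mul continuous_mul_log).sub
      ((continuous_pow 2).div_const 4)).continuousOn
  · have hs0 : s ≠ 0 := (hL.trans_lt hs.1).ne'
    have h1 : HasDerivAt (fun s : ℝ ↦ s ^ 2 / 2) s s := by
      simpa using (hasDerivAt_pow 2 s).div_const 2
    have h : HasDerivAt (fun s : ℝ ↦ s ^ 2 / 2 * Real.log s - s ^ 2 / 4)
        (s * Real.log s + s ^ 2 / 2 * s⁻¹ - (2 : ℕ) * s ^ (2 - 1) / 4) s :=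
      (h1.mul (Real.hasDerivAt_log hs0)).sub ((hasDerivAt_pow 2 s).div_const 4)
    refine h.congr_deriv ?_
    field_simp
    ring

/-- `∫_L^M s log (max s t) ds = ∫_L^M s log s ds` when `t ≤ L ≤ M` (the point inside the hole). -/
theorem integral_mul_log_max_of_le {L M t : ℝ} (htL : t ≤ L) (hLM : L ≤ M) :
    ∫ s in L..M, s * Real.log (max s t) = ∫ s in L..M, s * Real.log s := by
  refine intervalIntegral.integral_congr fun s hs ↦ ?_
  rw [uIcc_of_le hLM] at hs
  simp only [max_eq_left (htL.trans hs.1)]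

/-- `∫_L^M s log (max s t) ds = (M² - L²)/2 · log t` when `L ≤ M ≤ t` (the point outside). -/
theorem integral_mul_log_max_of_ge {L M t : ℝ} (hMt : M ≤ t) (hLM : L ≤ M) :
    ∫ s in L..M, s * Real.log (max s t) = (M ^ 2 - L ^ 2) / 2 * Real.log t := by
  rw [intervalIntegral.integral_congr (g := fun s ↦ s * Real.log t) fun s hs ↦ by
    rw [uIcc_of_le hLM] at hs
    simp only [max_eq_right (hs.2.trans hMt)], intervalIntegral.integral_mul_const, integral_id]

/-- `∫_L^M s log (max s t) ds` when `L ≤ t ≤ M`, `0 < t` (the point inside the shell): split the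
integral at `t`. -/
theorem integral_mul_log_max_of_mem {L M t : ℝ} (ht : 0 < t) (hLt : L ≤ t) (htM : t ≤ M) :
    ∫ s in L..M, s * Real.log (max s t) =
      (t ^ 2 - L ^ 2) / 2 * Real.log t +
        ((M ^ 2 / 2 * Real.log M - M ^ 2 / 4) - (t ^ 2 / 2 * Real.log t - t ^ 2 / 4)) := by
  have hc : Continuous fun s : ℝ ↦ s * Real.log (max s t) :=
    continuous_id.mul ((continuous_id.max continuous_const).log fun s ↦
      (lt_max_of_lt_right ht).ne')
  rw [← intervalIntegral.integral_add_adjacent_intervals (b := t) (hc.intervalIntegrable _ _)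
    (hc.intervalIntegrable _ _), integral_mul_log_max_of_ge le_rfl hLt,
    integral_mul_log_max_of_le le_rfl htM, integral_mul_log ht.le htM]

end Summit.CriticalPhenomena.CardyFormulaZ2.Cruxes.NestingRigidity.RingCloudTomography

end
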